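import Mathlib
import Literature.Analysis.Calculus.EnergyTailCutoff
import HarnessLib

/-!
# Cutting off finite-energy Cauchy data on a far half-line

Analysis/PDE support file (everything proved, no definitions). A packaging of
`Literature.Analysis.Calculus.energy_tail_cutoff_small` in the form used by the far-side channel
estimate: there is an absolute constant `Cc` such that for a continuous potential `V ≥ 0` with
`V(x) ≥ x⁻²` on `[ρ,∞)` (`ρ ≥ 1`), Cauchy data `(f,g)` (`f ∈ C²`, `g ∈ C¹`) of finite energy
`∫_{x>1} g² + f'² + Vf² < ∞`, and `θ > 0`, there are `X ≥ ρ` and cut-off data `(f_X,g_X)`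
(`= (f,g)` on `(−∞,X]`, `= 0` on `[2X,∞)`, same regularity) with
* tail energy `∫_{x>ρ} (g−g_X)² + ((f−f_X)')² + V(f−f_X)² ≤ θ`, and
* cut-off energy `∫_{x>ρ} g_X² + f_X'² + Vf_X² ≤ Cc ∫_{x>ρ} g² + f'² + Vf²`
(`exists_cutoffData`; the second bound uses `x⁻² ≤ V` to pay for the cut-off derivative). Route
PhotonSphereChannels, `FixedModeChannels`, far side (stmt-FinalStateConjecture-10048): compactly
supported data are dense in energy, which reduces the far channel estimate to the exact channel
inequality for compactly supported data. Folklore.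
-/

noncomputable section

namespace Literature.Analysis.PDE

open MeasureTheory Set Filter Topology Literature.Analysis.Calculus

/-- **Cut-off data on a far half-line.** See the module docstring. [folklore] -/
theorem exists_cutoffData : ∃ Cc : ℝ, 0 ≤ Cc ∧ ∀ {V : ℝ → ℝ}, Continuous V → (∀ x, 0 ≤ V x) →
    ∀ {ρ : ℝ}, 1 ≤ ρ → (∀ x, ρ ≤ x → (x ^ 2)⁻¹ ≤ V x) →
    ∀ {f g : ℝ → ℝ}, ContDiff ℝ 2 f → ContDiff ℝ 1 g →
    IntegrableOn (fun x => g x ^ 2 + deriv f x ^ 2 + V x * f x ^ 2) (Ioi 1) →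
    ∀ {θ : ℝ}, 0 < θ →
    ∃ (X : ℝ) (fX gX : ℝ → ℝ), ρ ≤ X ∧ ContDiff ℝ 2 fX ∧ ContDiff ℝ 1 gX ∧
      (∀ x, 2 * X ≤ x → fX x = 0) ∧ (∀ x, 2 * X ≤ x → gX x = 0) ∧
      IntegrableOn (fun x => (g x - gX x) ^ 2 + deriv (fun y => f y - fX y) x ^ 2
        + V x * (f x - fX x) ^ 2) (Ioi ρ) ∧
      ∫ x in Ioi ρ, ((g x - gX x) ^ 2 + deriv (fun y => f y - fX y) x ^ 2
        + V x * (f x - fX x) ^ 2) ≤ θ ∧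
      IntegrableOn (fun x => gX x ^ 2 + deriv fX x ^ 2 + V x * fX x ^ 2) (Ioi ρ) ∧
      ∫ x in Ioi ρ, (gX x ^ 2 + deriv fX x ^ 2 + V x * fX x ^ 2)
        ≤ Cc * ∫ x in Ioi ρ, (g x ^ 2 + deriv f x ^ 2 + V x * f x ^ 2) := by
  obtain ⟨χ, hχC, hχ1, hχ2, hχ01, C, hC0, hC⟩ := exists_smooth_cutoff
  refine ⟨2 + 8 * C ^ 2, by positivity, ?_⟩
  intro V hV hV0 ρ hρ1 hVlow f g hf hg hfin θ hθ
  have hf1 : ContDiff ℝ 1 f := hf.of_le (by norm_num)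
  have hfd : Continuous (deriv f) := hf.continuous_deriv (by norm_num)
  have hdens_c : Continuous fun x => g x ^ 2 + deriv f x ^ 2 + V x * f x ^ 2 :=
    ((hg.continuous.pow 2).add (hfd.pow 2)).add (hV.mul (hf.continuous.pow 2))
  -- the three pieces of the energy are integrable on `(1, ∞)`
  have hnn : ∀ x, 0 ≤ g x ^ 2 + deriv f x ^ 2 + V x * f x ^ 2 := fun x => by
    have := hV0 x; positivity
  have hE1 : IntegrableOn (fun x => deriv f x ^ 2) (Ioi 1) :=
    Integrable.mono' hfin (hfd.pow 2).aestronglyMeasurable (ae_of_all _ fun x => by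
      rw [Real.norm_eq_abs, abs_of_nonneg (sq_nonneg _)]
      nlinarith [sq_nonneg (g x), mul_nonneg (hV0 x) (sq_nonneg (f x))])
  have hE2 : IntegrableOn (fun x => V x * f x ^ 2) (Ioi 1) :=
    Integrable.mono' hfin (hV.mul (hf.continuous.pow 2)).aestronglyMeasurable
      (ae_of_all _ fun x => by
        rw [Real.norm_eq_abs, abs_of_nonneg (mul_nonneg (hV0 x) (sq_nonneg _))]
        nlinarith [sq_nonneg (g x), sq_nonneg (deriv f x)])
  have hE3 : IntegrableOn (fun x => g x ^ 2) (Ioi 1) :=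
    Integrable.mono' hfin (hg.continuous.pow 2).aestronglyMeasurable (ae_of_all _ fun x => by
      rw [Real.norm_eq_abs, abs_of_nonneg (sq_nonneg _)]
      nlinarith [sq_nonneg (deriv f x), mul_nonneg (hV0 x) (sq_nonneg (f x))])
  obtain ⟨R₀, hR₀1, hR⟩ := energy_tail_cutoff_small hf1 hg.continuous hV hV0 hE1 hE2 hE3 hχC hχ1
    hχ2 hχ01 hC hθ
  set X : ℝ := max R₀ ρ with hX
  have hXρ : ρ ≤ X := le_max_right _ _
  have hX1 : 1 ≤ X := hρ1.trans hXρ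
  have hX0 : 0 < X := by linarith
  obtain ⟨htail_i, htail⟩ := hR X (le_max_left _ _)
  -- the cut-off data
  set fX : ℝ → ℝ := fun x => χ (x / X) * f x with hfX
  set gX : ℝ → ℝ := fun x => χ (x / X) * g x with hgX
  have hcut : ∀ m : ℕ, ContDiff ℝ m fun x => χ (x / X) := fun m =>
    (hχC.of_le (by exact_mod_cast le_top)).comp (contDiff_id.div_const X)
  have hfXC : ContDiff ℝ 2 fX := (hcut 2).mul hf
  have hgXC : ContDiff ℝ 1 gX := (hcut 1).mul hg
  have hsupp : ∀ x, 2 * X ≤ x → χ (x / X) = 0 := fun x hx =>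
    hχ2 _ ((le_div_iff₀ hX0).2 (by linarith))
  refine ⟨X, fX, gX, hXρ, hfXC, hgXC, fun x hx => by simp only [hfX, hsupp x hx, zero_mul],
    fun x hx => by simp only [hgX, hsupp x hx, zero_mul], ?_, ?_, ?_, ?_⟩
  -- the tail
  · have hfun : (fun x => (g x - gX x) ^ 2 + deriv (fun y => f y - fX y) x ^ 2
        + V x * (f x - fX x) ^ 2) = fun x => deriv (fun y => (1 - χ (y / X)) * f y) x ^ 2
        + V x * ((1 - χ (x / X)) * f x) ^ 2 + ((1 - χ (x / X)) * g x) ^ 2 := by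
      funext x
      have : (fun y => f y - fX y) = fun y => (1 - χ (y / X)) * f y := funext fun y => by
        simp only [hfX]; ring
      rw [this]; simp only [hfX, hgX]; ring
    rw [hfun]
    exact htail_i.mono_set (Ioi_subset_Ioi hρ1)
  · have hfun : (fun x => (g x - gX x) ^ 2 + deriv (fun y => f y - fX y) x ^ 2
        + V x * (f x - fX x) ^ 2) = fun x => deriv (fun y => (1 - χ (y / X)) * f y) x ^ 2
        + V x * ((1 - χ (x / X)) * f x) ^ 2 + ((1 - χ (x / X)) * g x) ^ 2 := by
      funext x
      have : (fun y => f y - fX y) = fun y => (1 - χ (y / X)) * f y := funext fun y => by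
        simp only [hfX]; ring
      rw [this]; simp only [hfX, hgX]; ring
    rw [hfun]
    refine le_trans (setIntegral_mono_set htail_i (ae_of_all _ fun x => ?_)
      (ae_of_all _ (Ioi_subset_Ioi hρ1))) htail
    have := hV0 x; positivity
  -- the cut-off energy: pointwise bound
  · have hpt : ∀ x ∈ Ioi ρ, gX x ^ 2 + deriv fX x ^ 2 + V x * fX x ^ 2
        ≤ (2 + 8 * C ^ 2) * (g x ^ 2 + deriv f x ^ 2 + V x * f x ^ 2) := by
      intro x hx
      have hxρ : ρ ≤ x := le_of_lt hx
      have hx0 : 0 < x := by linarith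
      rcases le_or_gt x (2 * X) with hx2 | hx2
      · -- product rule
        have hχd : HasDerivAt (fun y => χ (y / X)) (deriv χ (x / X) / X) x := by
          have h1 : HasDerivAt (fun y => y / X) (1 / X) x := (hasDerivAt_id x).div_const X
          exact (((hχC.differentiable (by simp)) (x / X)).hasDerivAt.comp x h1).congr_deriv
            (by ring)
        have hd : deriv fX x = deriv χ (x / X) / X * f x + χ (x / X) * deriv f x := by
          have := hχd.fun_mul ((hf.differentiable (by norm_num)) x).hasDerivAt
          simpa only [hfX] using this.deriv
        have ha : |deriv χ (x / X) / X| ≤ |deriv χ (x / X) / X| := le_rfl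
        have hb := cutoff_density_le (h := f x) (h' := deriv f x) (g := g x) ha (hχ01 (x / X)).1
          (hχ01 (x / X)).2 (hV0 x)
        have hgx : gX x = χ (x / X) * g x := rfl
        have hfx : fX x = χ (x / X) * f x := rfl
        rw [hd, hgx, hfx]
        -- the cut-off derivative term against `V f²`
        have h3 : (deriv χ (x / X) / X) ^ 2 * f x ^ 2 ≤ 4 * C ^ 2 * (V x * f x ^ 2) := by
          have hc2 : (deriv χ (x / X)) ^ 2 ≤ C ^ 2 := by
            rw [← sq_abs]; exact pow_le_pow_left₀ (abs_nonneg _) (hC _) 2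
          have hX2 : (X ^ 2)⁻¹ ≤ 4 * V x := by
            have h4 : (X ^ 2)⁻¹ ≤ 4 * (x ^ 2)⁻¹ := by
              rw [show (4 : ℝ) * (x ^ 2)⁻¹ = ((x / 2) ^ 2)⁻¹ by field_simp; ring]
              apply inv_anti₀ (by positivity)
              apply pow_le_pow_left₀ (by positivity) (by linarith)
            linarith [hVlow x hxρ]
          calc (deriv χ (x / X) / X) ^ 2 * f x ^ 2
              = (deriv χ (x / X)) ^ 2 * (X ^ 2)⁻¹ * f x ^ 2 := by field_simp
            _ ≤ C ^ 2 * (4 * V x) * f x ^ 2 := by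
                apply mul_le_mul_of_nonneg_right _ (sq_nonneg _)
                exact mul_le_mul hc2 hX2 (by positivity) (by positivity)
            _ = _ := by ring
        have hsq : |deriv χ (x / X) / X| ^ 2 = (deriv χ (x / X) / X) ^ 2 := sq_abs _
        have hVx := hV0 x
        nlinarith [hb, h3, hsq, sq_nonneg (g x), sq_nonneg (deriv f x),
          mul_nonneg hVx (sq_nonneg (f x)), sq_nonneg C]
      · -- beyond `2X` the cut-off data vanish identically near `x`
        have hev : ∀ᶠ y in 𝓝 x, fX y = (fun _ => (0 : ℝ)) y := by
          filter_upwards [Ioi_mem_nhds hx2] with y hy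
          simp only [hfX, hsupp y (le_of_lt hy), zero_mul]
        have hd0 : deriv fX x = 0 := by
          rw [Filter.EventuallyEq.deriv_eq hev, deriv_const]
        have hf0 : fX x = 0 := by simp only [hfX, hsupp x (le_of_lt hx2), zero_mul]
        have hg0 : gX x = 0 := by simp only [hgX, hsupp x (le_of_lt hx2), zero_mul]
        rw [hd0, hf0, hg0]
        have := hnn x
        have : (0 : ℝ) ≤ 2 + 8 * C ^ 2 := by positivity
        nlinarith
    have hcont : Continuous fun x => gX x ^ 2 + deriv fX x ^ 2 + V x * fX x ^ 2 :=
      ((hgXC.continuous.pow 2).add ((hfXC.continuous_deriv (by norm_num)).pow 2)).add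
        (hV.mul (hfXC.continuous.pow 2))
    have hmaj : IntegrableOn (fun x => (2 + 8 * C ^ 2) * (g x ^ 2 + deriv f x ^ 2 + V x * f x ^ 2))
        (Ioi ρ) := (hfin.mono_set (Ioi_subset_Ioi hρ1)).const_mul _
    have hint : IntegrableOn (fun x => gX x ^ 2 + deriv fX x ^ 2 + V x * fX x ^ 2) (Ioi ρ) :=
      Integrable.mono' hmaj hcont.aestronglyMeasurable ((ae_restrict_iff' measurableSet_Ioi).2
        (ae_of_all _ fun x hx => by
          rw [Real.norm_eq_abs, abs_of_nonneg (by have := hV0 x; positivity)]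
          exact hpt x hx))
    exact hint
  · -- (the same facts once more, for the integral bound)
    have hpt : ∀ x ∈ Ioi ρ, gX x ^ 2 + deriv fX x ^ 2 + V x * fX x ^ 2
        ≤ (2 + 8 * C ^ 2) * (g x ^ 2 + deriv f x ^ 2 + V x * f x ^ 2) := by
      intro x hx
      have hxρ : ρ ≤ x := le_of_lt hx
      have hx0 : 0 < x := by linarith
      rcases le_or_gt x (2 * X) with hx2 | hx2
      · have hχd : HasDerivAt (fun y => χ (y / X)) (deriv χ (x / X) / X) x := by
          have h1 : HasDerivAt (fun y => y / X) (1 / X) x := (hasDerivAt_id x).div_const X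
          exact (((hχC.differentiable (by simp)) (x / X)).hasDerivAt.comp x h1).congr_deriv
            (by ring)
        have hd : deriv fX x = deriv χ (x / X) / X * f x + χ (x / X) * deriv f x := by
          have := hχd.fun_mul ((hf.differentiable (by norm_num)) x).hasDerivAt
          simpa only [hfX] using this.deriv
        have ha : |deriv χ (x / X) / X| ≤ |deriv χ (x / X) / X| := le_rfl
        have hb := cutoff_density_le (h := f x) (h' := deriv f x) (g := g x) ha (hχ01 (x / X)).1
          (hχ01 (x / X)).2 (hV0 x)
        have hgx : gX x = χ (x / X) * g x := rfl
        have hfx : fX x = χ (x / X) * f x := rfl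
        rw [hd, hgx, hfx]
        have h3 : (deriv χ (x / X) / X) ^ 2 * f x ^ 2 ≤ 4 * C ^ 2 * (V x * f x ^ 2) := by
          have hc2 : (deriv χ (x / X)) ^ 2 ≤ C ^ 2 := by
            rw [← sq_abs]; exact pow_le_pow_left₀ (abs_nonneg _) (hC _) 2
          have hX2 : (X ^ 2)⁻¹ ≤ 4 * V x := by
            have h4 : (X ^ 2)⁻¹ ≤ 4 * (x ^ 2)⁻¹ := by
              rw [show (4 : ℝ) * (x ^ 2)⁻¹ = ((x / 2) ^ 2)⁻¹ by field_simp; ring]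
              apply inv_anti₀ (by positivity)
              apply pow_le_pow_left₀ (by positivity) (by linarith)
            linarith [hVlow x hxρ]
          calc (deriv χ (x / X) / X) ^ 2 * f x ^ 2
              = (deriv χ (x / X)) ^ 2 * (X ^ 2)⁻¹ * f x ^ 2 := by field_simp
            _ ≤ C ^ 2 * (4 * V x) * f x ^ 2 := by
                apply mul_le_mul_of_nonneg_right _ (sq_nonneg _)
                exact mul_le_mul hc2 hX2 (by positivity) (by positivity)
            _ = _ := by ring
        have hsq : |deriv χ (x / X) / X| ^ 2 = (deriv χ (x / X) / X) ^ 2 := sq_abs _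
        have hVx := hV0 x
        nlinarith [hb, h3, hsq, sq_nonneg (g x), sq_nonneg (deriv f x),
          mul_nonneg hVx (sq_nonneg (f x)), sq_nonneg C]
      · have hev : ∀ᶠ y in 𝓝 x, fX y = (fun _ => (0 : ℝ)) y := by
          filter_upwards [Ioi_mem_nhds hx2] with y hy
          simp only [hfX, hsupp y (le_of_lt hy), zero_mul]
        have hd0 : deriv fX x = 0 := by
          rw [Filter.EventuallyEq.deriv_eq hev, deriv_const]
        have hf0 : fX x = 0 := by simp only [hfX, hsupp x (le_of_lt hx2), zero_mul]
        have hg0 : gX x = 0 := by simp only [hgX, hsupp x (le_of_lt hx2), zero_mul]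
        rw [hd0, hf0, hg0]
        have := hnn x
        have : (0 : ℝ) ≤ 2 + 8 * C ^ 2 := by positivity
        nlinarith
    have hcont : Continuous fun x => gX x ^ 2 + deriv fX x ^ 2 + V x * fX x ^ 2 :=
      ((hgXC.continuous.pow 2).add ((hfXC.continuous_deriv (by norm_num)).pow 2)).add
        (hV.mul (hfXC.continuous.pow 2))
    have hmaj : IntegrableOn (fun x => (2 + 8 * C ^ 2) * (g x ^ 2 + deriv f x ^ 2 + V x * f x ^ 2))
        (Ioi ρ) := (hfin.mono_set (Ioi_subset_Ioi hρ1)).const_mul _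
    have hint : IntegrableOn (fun x => gX x ^ 2 + deriv fX x ^ 2 + V x * fX x ^ 2) (Ioi ρ) :=
      Integrable.mono' hmaj hcont.aestronglyMeasurable ((ae_restrict_iff' measurableSet_Ioi).2
        (ae_of_all _ fun x hx => by
          rw [Real.norm_eq_abs, abs_of_nonneg (by have := hV0 x; positivity)]
          exact hpt x hx))
    calc ∫ x in Ioi ρ, (gX x ^ 2 + deriv fX x ^ 2 + V x * fX x ^ 2)
        ≤ ∫ x in Ioi ρ, (2 + 8 * C ^ 2) * (g x ^ 2 + deriv f x ^ 2 + V x * f x ^ 2) :=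
          setIntegral_mono_on hint hmaj measurableSet_Ioi hpt
      _ = _ := integral_const_mul _ _

end Literature.Analysis.PDE
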